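import Summits.QuantumFields.BalabanUV.Beta.FP.NestedStepLawJetsCorner

/-!
# `BalabanUV.Beta.FP.GradedCompanionShear` — road «FP» for binder row D1, ROUTE T, the R-FP-59 companion pair (Δ1): **A PULLED-BACK COMPANION IS INVISIBLE
# TO THE NESTED (GRADED) SLICED 2-JET** — part (N) of the companion adapter (leaf-02 g24 scoping S-leaf02-g24-1).

WHAT (generic finite matrices over `ℝ`; [folklore]).  Data: the nested sliced system `K₀ = kkt H₀ [Q₁₀; τ₁]` (invertible), ANY first jet of block shape
`fromBlocks J X B 0` (the graded door's `fromBlocks H₁ (−Bᵀ) B 0` is the case `X := −Bᵀ`), ANY second jet `fromBlocks H₂ Y Z W`.  Add to the form blocks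
the PULLED-BACK companions of the coarse `(fields, fields)` block: `J ↦ J + Q₁₀ᵀ·G₁·Q₁₀` (order 1) and `H₂ ↦ H₂ + (Q₁₀ᵀ·U + V·Q₁₀)` (order 2: every
companion cross term of p308750's `h𝔎₂` — `−Q₁₁ᵀG₁Q₁₀`, `Q₁₀ᵀG₂Q₁₀`, `Q₁₀ᵀG₁Q₁₁` — has `Q₁₀ᵀ` on the left or `Q₁₀` on the right).  THEN
**`secondVar K₀ (fromBlocks (J + Q₁₀ᵀG₁Q₁₀) X B 0) (fromBlocks (H₂ + (Q₁₀ᵀU + VQ₁₀)) Y Z W) = secondVar K₀ (fromBlocks J X B 0) (fromBlocks H₂ Y Z W)`**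
(`secondVar_companion_shear`; `toBlocks₁₁_add_blockDiag` BY NAME from `NestedStepLawJetsCorner`).  Proof: `K₀⁻¹ = [[Γ, I],[L, −S]]` (`CompositionSingular.kktInv_eq_fromBlocks`) with `Γ·Q₁₀ᵀ = 0`, `Q₁₀·Γ = 0`
(`flucCov_mul_transpose`, `mul_flucCov` read on the `Q₁₀` rows of `[Q₁₀; τ₁]`); the order-2 shift contributes `tr(Γ·(Q₁₀ᵀU + VQ₁₀)) = 0`; the order-1 shift
`N := K₀⁻¹·diag(Q₁₀ᵀG₁Q₁₀, 0) = [[0, 0],[L·Q₁₀ᵀG₁Q₁₀, 0]]` is nilpotent with `tr(M·N) = tr(Γ·X·L·Q₁₀ᵀG₁·Q₁₀) = tr(Q₁₀Γ·…) = 0` against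
`M := K₀⁻¹·(first jet)`.  USE (the companion U-file, R-FP-59 (Δ1)–(Δ3)): the graded torus door at the `…GradedGenSymULowClosed` level applied to the TOTAL
first∕second form jets `𝔎₁ = H₁ + Q₁₀ᵀΛ₁ᴳQ₁₀`, `𝔎₂ = H₂ + (cross terms)` has the SAME nested term as for `H₁ H₂` — the companion lives on the coarse side only.
No `def`, no `def … : Prop`, nothing cited, 0 sorry.  Nothing of the dictionary ∕ Bałaban's asserted.

HONEST DEPENDENCY (page 1, mandatory): continuum YM on T⁴ ⇐ BetaPertH ∧ nine spine estimates (0/9 proved); BetaPertH ⇐ (D1) ∧ (D4) ∧ CAP+tail;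
G-an2-4 gates asym, D1 and NE2/3/4.  HONEST FRAMING (cell contract, verbatim): «discharging `BetaPertH` makes Bałaban's UV stability UNCONDITIONAL —
a real constructive-QFT result; it is NOT the continuum limit and NOT the Clay problem.»  ABSOLUTE RULE (cell charter, verbatim): «No internally-minted
statement may enter as a cited fact. Every hypothesis is either kernel-proved in this package or a verbatim quotation of a PUBLISHED theorem with page
reference. The manuscript(s) under audit are NOT citable for their own disputed steps — they are the thing under adjudication; programme-internal
(2001/route/tribunal) claims are never citable.»  0 estimates; 0∕4 row-D1 binders; NOT (T-ID), NOT SDF, NOT D1, NOT BetaPertH, NOT continuum, NOT Clay.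
D1 formalisation swarm LEAF PROVER 02 (b2b-balaban-beta-d1-formalise-leaf-02 gen 24), 2026-08-23.  No existing file touched.
-/

namespace Summit.QuantumFields.BalabanUV.Beta.FP.GradedCompanionShear

open Matrix
open Literature.MathematicalPhysics.QuantumFieldTheory.Balaban1983to89.Beta.Composition (kkt)
open Literature.MathematicalPhysics.QuantumFieldTheory.Balaban1983to89.Beta.CompositionSingular (effForm flucCov minOp minOpL kktInv_eq_fromBlocks
  flucCov_mul_transpose mul_flucCov)
open Summit.QuantumFields.BalabanUV.Beta.D1BFx.LogDetSecondVariation (secondVar)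
open Summit.QuantumFields.BalabanUV.Beta.FP.NestedStepLawJetsCorner (toBlocks₁₁_add_blockDiag)

variable {ν μ ρ : Type*} [Fintype ν] [Fintype μ] [Fintype ρ] [DecidableEq ν] [DecidableEq μ] [DecidableEq ρ]

omit [DecidableEq ν] [DecidableEq μ] [DecidableEq ρ] in
/-- [folklore] trace of a `2 × 2` block matrix. -/
theorem trace_fromBlocks' (A : Matrix ν ν ℝ) (B : Matrix ν (μ ⊕ ρ) ℝ) (C : Matrix (μ ⊕ ρ) ν ℝ) (D : Matrix (μ ⊕ ρ) (μ ⊕ ρ) ℝ) :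
    (fromBlocks A B C D).trace = A.trace + D.trace := by
  simp [Matrix.trace, Matrix.diag, Fintype.sum_sum_type]

/-- [folklore] the fluctuation covariance of `kkt H₀ [Q₁₀; τ₁]` is killed by the averaging rows on BOTH sides: `Γ·Q₁₀ᵀ = 0` and `Q₁₀·Γ = 0`. -/
theorem flucCov_mul_transpose_rows (H₀ : Matrix ν ν ℝ) (Q₁₀ : Matrix μ ν ℝ) (τ₁ : Matrix ρ ν ℝ) (h : IsUnit (kkt H₀ (fromRows Q₁₀ τ₁)).det) :
    flucCov H₀ (fromRows Q₁₀ τ₁) * Q₁₀ᵀ = 0 ∧ Q₁₀ * flucCov H₀ (fromRows Q₁₀ τ₁) = 0 := by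
  constructor
  · have h1 := flucCov_mul_transpose H₀ (fromRows Q₁₀ τ₁) h
    rw [transpose_fromRows, mul_fromCols] at h1
    have := congrArg Matrix.toCols₁ h1
    rw [toCols₁_fromCols] at this
    rw [this]
    rfl
  · have h2 := mul_flucCov H₀ (fromRows Q₁₀ τ₁) h
    rw [fromRows_mul] at h2
    have := congrArg Matrix.toRows₁ h2
    rw [toRows₁_fromRows] at this
    rw [this]
    rfl

/-- [folklore] **A PULLED-BACK COMPANION IS INVISIBLE TO THE NESTED SLICED 2-JET (graded or not).**  `K₀ = kkt H₀ [Q₁₀; τ₁]` invertible; first jet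
`fromBlocks J X B 0` (ANY `J X B`; the graded door has `X = −Bᵀ`), second jet `fromBlocks H₂ Y Z W` (ANY); companions `G₁` (order 1, pulled back as
`Q₁₀ᵀG₁Q₁₀`) and an order-2 shift `Q₁₀ᵀU + VQ₁₀`:
`secondVar K₀ (fromBlocks (J + Q₁₀ᵀG₁Q₁₀) X B 0) (fromBlocks (H₂ + (Q₁₀ᵀU + VQ₁₀)) Y Z W) = secondVar K₀ (fromBlocks J X B 0) (fromBlocks H₂ Y Z W)`. -/
theorem secondVar_companion_shear (H₀ J H₂ : Matrix ν ν ℝ) (Q₁₀ : Matrix μ ν ℝ) (τ₁ : Matrix ρ ν ℝ)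
    (X Y : Matrix ν (μ ⊕ ρ) ℝ) (B Z : Matrix (μ ⊕ ρ) ν ℝ) (W : Matrix (μ ⊕ ρ) (μ ⊕ ρ) ℝ)
    (G₁ : Matrix μ μ ℝ) (U : Matrix μ ν ℝ) (V : Matrix ν μ ℝ)
    (h : IsUnit (kkt H₀ (fromRows Q₁₀ τ₁)).det) :
    secondVar (kkt H₀ (fromRows Q₁₀ τ₁)) (fromBlocks (J + Q₁₀ᵀ * G₁ * Q₁₀) X B 0) (fromBlocks (H₂ + (Q₁₀ᵀ * U + V * Q₁₀)) Y Z W)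
      = secondVar (kkt H₀ (fromRows Q₁₀ τ₁)) (fromBlocks J X B 0) (fromBlocks H₂ Y Z W) := by
  obtain ⟨hΓt, hQΓ⟩ := flucCov_mul_transpose_rows H₀ Q₁₀ τ₁ h
  set Γ := flucCov H₀ (fromRows Q₁₀ τ₁) with hΓ
  set I := minOp H₀ (fromRows Q₁₀ τ₁) with hI
  set L := minOpL H₀ (fromRows Q₁₀ τ₁) with hL
  set S := effForm H₀ (fromRows Q₁₀ τ₁) with hS
  have hinv : (kkt H₀ (fromRows Q₁₀ τ₁))⁻¹ = fromBlocks Γ I L (-S) := kktInv_eq_fromBlocks H₀ (fromRows Q₁₀ τ₁)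
  -- the two shifts as block matrices
  have e1 : fromBlocks (J + Q₁₀ᵀ * G₁ * Q₁₀) X B (0 : Matrix (μ ⊕ ρ) (μ ⊕ ρ) ℝ)
      = fromBlocks J X B 0 + fromBlocks (Q₁₀ᵀ * G₁ * Q₁₀) 0 0 0 := by
    rw [fromBlocks_add, add_zero, add_zero, add_zero]
  have e2 : fromBlocks (H₂ + (Q₁₀ᵀ * U + V * Q₁₀)) Y Z W = fromBlocks H₂ Y Z W + fromBlocks (Q₁₀ᵀ * U + V * Q₁₀) 0 0 0 := by
    rw [fromBlocks_add, add_zero, add_zero, add_zero]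
  -- the inverse against the shifts
  have hΓP : Γ * (Q₁₀ᵀ * G₁ * Q₁₀) = 0 := by rw [← Matrix.mul_assoc, ← Matrix.mul_assoc, hΓt, Matrix.zero_mul, Matrix.zero_mul]
  have hN : fromBlocks Γ I L (-S) * fromBlocks (Q₁₀ᵀ * G₁ * Q₁₀) 0 0 (0 : Matrix (μ ⊕ ρ) (μ ⊕ ρ) ℝ)
      = fromBlocks 0 0 (L * (Q₁₀ᵀ * G₁ * Q₁₀)) 0 := by
    rw [fromBlocks_multiply]
    simp only [Matrix.mul_zero, add_zero, hΓP]
  have hC : (Γ * (Q₁₀ᵀ * U + V * Q₁₀)).trace = 0 := by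
    rw [Matrix.mul_add, trace_add, ← Matrix.mul_assoc, hΓt, Matrix.zero_mul, trace_zero, zero_add, ← Matrix.mul_assoc,
      Matrix.trace_mul_comm, ← Matrix.mul_assoc, hQΓ, Matrix.zero_mul, trace_zero]
  have hN2 : fromBlocks Γ I L (-S) * fromBlocks (Q₁₀ᵀ * U + V * Q₁₀) 0 0 (0 : Matrix (μ ⊕ ρ) (μ ⊕ ρ) ℝ)
      = fromBlocks (Γ * (Q₁₀ᵀ * U + V * Q₁₀)) 0 (L * (Q₁₀ᵀ * U + V * Q₁₀)) 0 := by
    rw [fromBlocks_multiply]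
    simp only [Matrix.mul_zero, add_zero]
  -- `M := K₀⁻¹·(first jet)`, its (1,2) block is `Γ·X`
  have hM : fromBlocks Γ I L (-S) * fromBlocks J X B (0 : Matrix (μ ⊕ ρ) (μ ⊕ ρ) ℝ) = fromBlocks (Γ * J + I * B) (Γ * X) (L * J + -S * B) (L * X) := by
    rw [fromBlocks_multiply]
    simp only [Matrix.mul_zero, add_zero]
  -- the nilpotent shift: `N·N = 0`, `tr(M·N) = tr(N·M) = 0`
  have hNN : fromBlocks (0 : Matrix ν ν ℝ) (0 : Matrix ν (μ ⊕ ρ) ℝ) (L * (Q₁₀ᵀ * G₁ * Q₁₀)) (0 : Matrix (μ ⊕ ρ) (μ ⊕ ρ) ℝ)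
      * fromBlocks (0 : Matrix ν ν ℝ) (0 : Matrix ν (μ ⊕ ρ) ℝ) (L * (Q₁₀ᵀ * G₁ * Q₁₀)) (0 : Matrix (μ ⊕ ρ) (μ ⊕ ρ) ℝ) = 0 := by
    rw [fromBlocks_multiply]
    simp only [Matrix.mul_zero, Matrix.zero_mul, add_zero, fromBlocks_zero]
  have hMN : (fromBlocks (Γ * J + I * B) (Γ * X) (L * J + -S * B) (L * X)
      * fromBlocks (0 : Matrix ν ν ℝ) (0 : Matrix ν (μ ⊕ ρ) ℝ) (L * (Q₁₀ᵀ * G₁ * Q₁₀)) (0 : Matrix (μ ⊕ ρ) (μ ⊕ ρ) ℝ)).trace = 0 := by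
    rw [fromBlocks_multiply, trace_fromBlocks']
    simp only [Matrix.mul_zero, zero_add, add_zero, trace_zero]
    -- `tr(Γ·X·(L·(Q₁₀ᵀG₁Q₁₀))) = tr(Q₁₀·Γ·X·L·Q₁₀ᵀ·G₁) = 0`
    have : Γ * X * (L * (Q₁₀ᵀ * G₁ * Q₁₀)) = (Γ * X * L * Q₁₀ᵀ * G₁) * Q₁₀ := by simp only [Matrix.mul_assoc]
    rw [this, Matrix.trace_mul_comm, ← Matrix.mul_assoc, ← Matrix.mul_assoc, ← Matrix.mul_assoc, ← Matrix.mul_assoc, hQΓ]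
    simp only [Matrix.zero_mul, trace_zero]
  -- assemble
  unfold secondVar
  rw [hinv, e1, e2, Matrix.mul_add, Matrix.mul_add, hN, hN2, trace_add, trace_fromBlocks' (Γ * (Q₁₀ᵀ * U + V * Q₁₀)), hC, trace_zero, zero_add, add_zero,
    hM, Matrix.add_mul, Matrix.mul_add, Matrix.mul_add, hNN, add_zero, trace_add, trace_add, hMN, add_zero,
    Matrix.trace_mul_comm (fromBlocks (0 : Matrix ν ν ℝ) (0 : Matrix ν (μ ⊕ ρ) ℝ) (L * (Q₁₀ᵀ * G₁ * Q₁₀)) (0 : Matrix (μ ⊕ ρ) (μ ⊕ ρ) ℝ)), hMN, add_zero]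

open Literature.MathematicalPhysics.QuantumFieldTheory.Balaban1983to89.Beta.CompositionSingular (minOpL_mul_transpose mul_minOp)

/-! ## §2 The minimiser pair reads the averaging rows as the unit corner -/

/-- [folklore] `L·Q₁₀ᵀ = [1; 0]` and `Q₁₀·I = [1 | 0]` for the minimiser pair `(I, L) = (minOp, minOpL)` of `kkt H₀ [Q₁₀; τ₁]`. -/
theorem minOp_corner (H₀ : Matrix ν ν ℝ) (Q₁₀ : Matrix μ ν ℝ) (τ₁ : Matrix ρ ν ℝ) (h : IsUnit (kkt H₀ (fromRows Q₁₀ τ₁)).det) :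
    minOpL H₀ (fromRows Q₁₀ τ₁) * Q₁₀ᵀ = fromRows (1 : Matrix μ μ ℝ) (0 : Matrix ρ μ ℝ)
      ∧ Q₁₀ * minOp H₀ (fromRows Q₁₀ τ₁) = fromCols (1 : Matrix μ μ ℝ) (0 : Matrix μ ρ ℝ) := by
  constructor
  · have h1 := minOpL_mul_transpose H₀ (fromRows Q₁₀ τ₁) h
    rw [transpose_fromRows, mul_fromCols] at h1
    have := congrArg Matrix.toCols₁ h1
    rw [toCols₁_fromCols] at this
    rw [this]
    ext (i | i) j
    · simp [Matrix.toCols₁, Matrix.one_apply]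
    · simp [Matrix.toCols₁, Matrix.one_apply]
  · have h2 := mul_minOp H₀ (fromRows Q₁₀ τ₁) h
    rw [fromRows_mul] at h2
    have := congrArg Matrix.toRows₁ h2
    rw [toRows₁_fromRows] at this
    rw [this]
    ext i (j | j)
    · simp [Matrix.toRows₁, Matrix.one_apply]
    · simp [Matrix.toRows₁, Matrix.one_apply]

omit [Fintype ν] [Fintype ρ] [DecidableEq ν] [DecidableEq ρ] in
/-- [folklore] the unit corner sandwiches a coarse block into the block-diagonal: `[1;0]·G·[1|0] = diag(G, 0)`. -/
theorem corner_sandwich (G : Matrix μ μ ℝ) :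
    fromRows (1 : Matrix μ μ ℝ) (0 : Matrix ρ μ ℝ) * G * fromCols (1 : Matrix μ μ ℝ) (0 : Matrix μ ρ ℝ)
      = fromBlocks G (0 : Matrix μ ρ ℝ) (0 : Matrix ρ μ ℝ) (0 : Matrix ρ ρ ℝ) := by
  rw [fromRows_mul, fromRows_mul_fromCols]
  simp only [Matrix.one_mul, Matrix.zero_mul, Matrix.mul_one, Matrix.mul_zero]

/-! ## §3 The ORDER-1 dressed word of the TOTAL first jet is the bare word plus the companion -/

/-- [folklore] **(W1)** — with `(Γ, I, L, S)` the blocks of `(kkt H₀ [Q₁₀;τ₁])⁻¹` (only `L·Q₁₀ᵀ = [1;0]`, `Q₁₀·I = [1|0]` are used) and ANY `J S B`: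
`((L·(J + Q₁₀ᵀG₁Q₁₀) − S·B)·I + L·Bᵀ·S)₁₁ = ((L·J − S·B)·I + L·Bᵀ·S)₁₁ + G₁` — the coarse system's first-order dressed word of the total jet is the bare word
plus the companion `G₁` (R-FP-59's `WORD_j(h̄) + Λ₁ᴳ(h̄)`). -/
theorem orderOne_word_companion (H₀ J : Matrix ν ν ℝ) (Q₁₀ : Matrix μ ν ℝ) (τ₁ : Matrix ρ ν ℝ)
    (S : Matrix (μ ⊕ ρ) (μ ⊕ ρ) ℝ) (B : Matrix (μ ⊕ ρ) ν ℝ) (G₁ : Matrix μ μ ℝ)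
    {I : Matrix ν (μ ⊕ ρ) ℝ} {L : Matrix (μ ⊕ ρ) ν ℝ} (hI : minOp H₀ (fromRows Q₁₀ τ₁) = I) (hL : minOpL H₀ (fromRows Q₁₀ τ₁) = L)
    (h : IsUnit (kkt H₀ (fromRows Q₁₀ τ₁)).det) :
    ((L * (J + Q₁₀ᵀ * G₁ * Q₁₀) - S * B) * I + L * Bᵀ * S).toBlocks₁₁ = ((L * J - S * B) * I + L * Bᵀ * S).toBlocks₁₁ + G₁ := by
  obtain ⟨hLQ, hQI⟩ := minOp_corner H₀ Q₁₀ τ₁ h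
  rw [hL] at hLQ
  rw [hI] at hQI
  have key : (L * (J + Q₁₀ᵀ * G₁ * Q₁₀) - S * B) * I + L * Bᵀ * S
      = ((L * J - S * B) * I + L * Bᵀ * S) + (L * Q₁₀ᵀ) * G₁ * (Q₁₀ * I) := by
    simp only [Matrix.mul_add, Matrix.add_mul, Matrix.sub_mul, Matrix.mul_assoc]
    abel
  rw [key, hLQ, hQI, corner_sandwich, toBlocks₁₁_add_blockDiag]

/-! ## §4 The ORDER-2 graded dressed word of the TOTAL jets is the bare word plus the order-2 companion -/

omit [DecidableEq ν] [DecidableEq ρ] in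
/-- [folklore] **(W2), algebraic core** — abstract blocks `Γ I L S` with ONLY the four corner identities `Γ·Q₁₀ᵀ = 0`, `Q₁₀·Γ = 0`, `L·Q₁₀ᵀ = [1;0]`,
`Q₁₀·I = [1|0]`, the first border jet `B = [Q₁₁; 0]`, ANY `J H₂ S R`: the GRADED second dressed word (U21's, `Bᵀ ↦ −Bᵀ` placements) of the total jets
`J + Q₁₀ᵀG₁Q₁₀`, `H₂ + C` with the graded companion cross terms `C = −Q₁₁ᵀG₁Q₁₀ − Q₁₁ᵀG₁Q₁₀ + Q₁₀ᵀG₂Q₁₀ + Q₁₀ᵀG₁Q₁₁ + Q₁₀ᵀG₁Q₁₁` (the graded `h𝔎₂` at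
`G₀ = 0`) equals the bare word plus `[1;0]·G₂·[1|0]`. -/
theorem orderTwo_word_companion_graded_core (J H₂ Γ : Matrix ν ν ℝ) (Q₁₀ Q₁₁ : Matrix μ ν ℝ)
    (I : Matrix ν (μ ⊕ ρ) ℝ) (L R B : Matrix (μ ⊕ ρ) ν ℝ) (S : Matrix (μ ⊕ ρ) (μ ⊕ ρ) ℝ) (G₁ G₂ : Matrix μ μ ℝ)
    (hΓQ : Γ * Q₁₀ᵀ = 0) (hQΓ : Q₁₀ * Γ = 0)
    (hLQ : L * Q₁₀ᵀ = fromRows (1 : Matrix μ μ ℝ) (0 : Matrix ρ μ ℝ)) (hQI : Q₁₀ * I = fromCols (1 : Matrix μ μ ℝ) (0 : Matrix μ ρ ℝ))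
    (hB : B = fromRows Q₁₁ (0 : Matrix ρ ν ℝ)) :
    (((-((L * (J + Q₁₀ᵀ * G₁ * Q₁₀) - S * B) * Γ - L * Bᵀ * L) * (J + Q₁₀ᵀ * G₁ * Q₁₀) + L * (H₂ + (-(Q₁₁ᵀ * G₁ * Q₁₀) - Q₁₁ᵀ * G₁ * Q₁₀ + Q₁₀ᵀ * G₂ * Q₁₀ + Q₁₀ᵀ * G₁ * Q₁₁ + Q₁₀ᵀ * G₁ * Q₁₁)) - (((L * (J + Q₁₀ᵀ * G₁ * Q₁₀) - S * B) * I + L * Bᵀ * S) * B + S * R)) * I + (L * (J + Q₁₀ᵀ * G₁ * Q₁₀) - S * B) * (-((Γ * (J + Q₁₀ᵀ * G₁ * Q₁₀) + I * B) * I + Γ * Bᵀ * S))) - ((-((L * (J + Q₁₀ᵀ * G₁ * Q₁₀) - S * B) * Γ - L * Bᵀ * L) * (-Bᵀ) + L * Rᵀ) * S + L * (-Bᵀ) * ((L * (J + Q₁₀ᵀ * G₁ * Q₁₀) - S * B) * I + L * Bᵀ * S)))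
      = (((-((L * J - S * B) * Γ - L * Bᵀ * L) * J + L * H₂ - (((L * J - S * B) * I + L * Bᵀ * S) * B + S * R)) * I + (L * J - S * B) * (-((Γ * J + I * B) * I + Γ * Bᵀ * S))) - ((-((L * J - S * B) * Γ - L * Bᵀ * L) * (-Bᵀ) + L * Rᵀ) * S + L * (-Bᵀ) * ((L * J - S * B) * I + L * Bᵀ * S)))
        + fromRows (1 : Matrix μ μ ℝ) (0 : Matrix ρ μ ℝ) * G₂ * fromCols (1 : Matrix μ μ ℝ) (0 : Matrix μ ρ ℝ) := by
  -- the corner identities in left-associated form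
  have v1 : ∀ Y : Matrix (μ ⊕ ρ) ν ℝ, Y * Γ * Q₁₀ᵀ = 0 := fun Y => by rw [Matrix.mul_assoc, hΓQ, Matrix.mul_zero]
  have v2 : ∀ Y : Matrix (μ ⊕ ρ) μ ℝ, Y * Q₁₀ * Γ = 0 := fun Y => by rw [Matrix.mul_assoc, hQΓ, Matrix.mul_zero]
  have v3 : ∀ Y : Matrix (μ ⊕ ρ) (μ ⊕ ρ) ℝ, Y * L * Q₁₀ᵀ = Y * fromRows (1 : Matrix μ μ ℝ) (0 : Matrix ρ μ ℝ) := fun Y => by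
    rw [Matrix.mul_assoc, hLQ]
  have v4 : ∀ Y : Matrix (μ ⊕ ρ) μ ℝ, Y * Q₁₀ * I = Y * fromCols (1 : Matrix μ μ ℝ) (0 : Matrix μ ρ ℝ) := fun Y => by
    rw [Matrix.mul_assoc, hQI]
  have v5 : ∀ Y : Matrix (μ ⊕ ρ) ν ℝ, Y * Bᵀ * fromRows (1 : Matrix μ μ ℝ) (0 : Matrix ρ μ ℝ) = Y * Q₁₁ᵀ := fun Y => by
    rw [Matrix.mul_assoc, hB, transpose_fromRows, fromCols_mul_fromRows, Matrix.mul_one, Matrix.mul_zero, add_zero]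
  have v6 : ∀ Y : Matrix (μ ⊕ ρ) μ ℝ, Y * fromCols (1 : Matrix μ μ ℝ) (0 : Matrix μ ρ ℝ) * B = Y * Q₁₁ := fun Y => by
    rw [Matrix.mul_assoc, hB, fromCols_mul_fromRows, Matrix.one_mul, Matrix.zero_mul, add_zero]
  simp only [Matrix.mul_add, Matrix.add_mul, Matrix.mul_sub, Matrix.sub_mul, Matrix.mul_neg, Matrix.neg_mul, neg_neg, ← Matrix.mul_assoc,
    v1, v2, v3, v4, hLQ, hΓQ, Matrix.zero_mul, sub_zero, zero_sub, add_zero]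
  simp only [v5, v6]
  abel

/-- [folklore] **(W2)** — at the blocks of `(kkt H₀ [Q₁₀; τ₁])⁻¹` (`hΓ hI hL`; `S` and `R` FREE), `B = [Q₁₁; 0]`: the graded second dressed word of the
TOTAL jets `(J + Q₁₀ᵀG₁Q₁₀, H₂ + C)` read on the coarse `(fields, fields)` block is the bare word plus `G₂` (R-FP-59: the fresh order-2 companion rides on
the coarse side). -/
theorem orderTwo_word_companion_graded (H₀ J H₂ : Matrix ν ν ℝ) (Q₁₀ Q₁₁ : Matrix μ ν ℝ) (τ₁ : Matrix ρ ν ℝ)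
    (R : Matrix (μ ⊕ ρ) ν ℝ) (S : Matrix (μ ⊕ ρ) (μ ⊕ ρ) ℝ) (G₁ G₂ : Matrix μ μ ℝ)
    {Γ : Matrix ν ν ℝ} {I : Matrix ν (μ ⊕ ρ) ℝ} {L B : Matrix (μ ⊕ ρ) ν ℝ}
    (hΓ : flucCov H₀ (fromRows Q₁₀ τ₁) = Γ) (hI : minOp H₀ (fromRows Q₁₀ τ₁) = I) (hL : minOpL H₀ (fromRows Q₁₀ τ₁) = L)
    (hB : fromRows Q₁₁ (0 : Matrix ρ ν ℝ) = B) (h : IsUnit (kkt H₀ (fromRows Q₁₀ τ₁)).det) :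
    ((((-((L * (J + Q₁₀ᵀ * G₁ * Q₁₀) - S * B) * Γ - L * Bᵀ * L) * (J + Q₁₀ᵀ * G₁ * Q₁₀) + L * (H₂ + (-(Q₁₁ᵀ * G₁ * Q₁₀) - Q₁₁ᵀ * G₁ * Q₁₀ + Q₁₀ᵀ * G₂ * Q₁₀ + Q₁₀ᵀ * G₁ * Q₁₁ + Q₁₀ᵀ * G₁ * Q₁₁)) - (((L * (J + Q₁₀ᵀ * G₁ * Q₁₀) - S * B) * I + L * Bᵀ * S) * B + S * R)) * I + (L * (J + Q₁₀ᵀ * G₁ * Q₁₀) - S * B) * (-((Γ * (J + Q₁₀ᵀ * G₁ * Q₁₀) + I * B) * I + Γ * Bᵀ * S))) - ((-((L * (J + Q₁₀ᵀ * G₁ * Q₁₀) - S * B) * Γ - L * Bᵀ * L) * (-Bᵀ) + L * Rᵀ) * S + L * (-Bᵀ) * ((L * (J + Q₁₀ᵀ * G₁ * Q₁₀) - S * B) * I + L * Bᵀ * S)))).toBlocks₁₁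
      = ((((-((L * J - S * B) * Γ - L * Bᵀ * L) * J + L * H₂ - (((L * J - S * B) * I + L * Bᵀ * S) * B + S * R)) * I + (L * J - S * B) * (-((Γ * J + I * B) * I + Γ * Bᵀ * S))) - ((-((L * J - S * B) * Γ - L * Bᵀ * L) * (-Bᵀ) + L * Rᵀ) * S + L * (-Bᵀ) * ((L * J - S * B) * I + L * Bᵀ * S)))).toBlocks₁₁
        + G₂ := by
  obtain ⟨hΓt, hQΓ⟩ := flucCov_mul_transpose_rows H₀ Q₁₀ τ₁ h
  obtain ⟨hLQ, hQI⟩ := minOp_corner H₀ Q₁₀ τ₁ h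
  rw [hΓ] at hΓt hQΓ
  rw [hL] at hLQ
  rw [hI] at hQI
  rw [orderTwo_word_companion_graded_core J H₂ Γ Q₁₀ Q₁₁ I L R B S G₁ G₂ hΓt hQΓ hLQ hQI hB.symm, corner_sandwich, toBlocks₁₁_add_blockDiag]

end Summit.QuantumFields.BalabanUV.Beta.FP.GradedCompanionShear
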